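import Mathlib
import Summits.ValiantsHypothesis.ValiantsHypothesis.Theses.GeneratorObstructions
import Literature.Computability.AlgebraicComplexity.MultiplicityObstructionsProofs

/-!
# The generator-obstruction principle (`GenPrinciple`, item `stmt-ValiantsHypothesis-11658`)

Route `ValiantsHypothesis/GeneratorObstructions`, support item #9 (card P1a–b).  We prove
`Summit.ValiantsHypothesis.ValiantsHypothesis.Theses.GeneratorObstructions.GenPrinciple`:
over `ℂ`, for forms `f, g` in finitely many linearly ordered variables, `m ≠ 0` and
`g ∈ Δ(f)`, for every weight `χ`

  `γ_χ(g) ≤ γ_χ(f)`,   `γ_χ(h) := dim HWV_χ(ℂ[Δ_m h]) ⧸ (HWV_χ ∩ Σ_{χ₁+χ₂=χ, χᵢ≠0} HWV_χ₁ · HWV_χ₂)`,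

the number of minimal generators of type `χ` of the algebra of highest-weight vectors
(`U`-invariants, covariants) of the coordinate ring of the orbit closure.

## Proof

The restriction map `π = orbitCoordRestrict m h : ℂ[Δ_m f] →ₐ ℂ[Δ_m g]` (`GCTObstructions`) is a
`GL`-equivariant ALGEBRA surjection.  Since `ℂ[Δ_m f]` is completely reducible
(`isSemisimpleRepresentation_orbitCoordRep`), highest-weight spaces surject:
`π(HWV_χ(f)) = HWV_χ(g)` (`map_highestWeightSpace_eq_of_surjective`, file
`MultiplicityObstructionsProofs`; Bläser–Ikenmeyer 2025, Cor. 12.6 with Prop. 12.7).  Because `π`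
is an algebra map, `π(M · N) = π(M) · π(N)` on submodules (`Submodule.map_mul`) and `π` commutes
with suprema, so the decomposable part `Σ HWV_χ₁(f) · HWV_χ₂(f)` maps ONTO the decomposable part of
`g`.  Hence `π` induces a surjection of the quotients `HWV_χ / (HWV_χ ∩ decomposables)`, and
`finrank` is monotone along surjections out of the finite-dimensional space `HWV_χ(f)`
(`finiteDimensional_highestWeightSpace_orbitCoordRep_holds`, `m ≠ 0`).

## References

* M. Bläser, C. Ikenmeyer, *Introduction to Geometric Complexity Theory*, Theory of Computing
  Graduate Surveys 10 (2025), §12.4, Cor. 12.6, Prop. 12.7. [BlaeserIkenmeyer2025]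
* P. Bürgisser, J. M. Landsberg, L. Manivel, J. Weyman, *An overview of mathematical issues
  arising in the geometric complexity theory approach to VP ≠ VNP*, SIAM J. Comput. 40 (2011),
  §6.1 (semigroup property of highest-weight vectors). [arXiv:0907.2850]
* H. Derksen, V. Makam, *Algorithms for orbit closure separation …*, Adv. Math. (2020),
  Lemma 1.3 (surjections preserve generating sets). [DerksenMakam2020]
-/

namespace Summit.ValiantsHypothesis.ValiantsHypothesis.Theorems.GeneratorObstructionsGenPrinciple

set_option linter.dupNamespace false

open Literature.Computability.AlgebraicComplexity
open Literature.NumberTheory.DiophantineGeometry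

/-- **Quotients by the decomposable part along a map.** Pure linear algebra: if a linear map `π`
carries `Hf` ONTO `Hg` and `Df` INTO `Dg`, and `Hf` is finite-dimensional, then
`dim Hg ⧸ (Hg ∩ Dg) ≤ dim Hf ⧸ (Hf ∩ Df)` (the induced map of quotients is surjective). [folklore] -/
theorem finrank_quotient_comap_le_of_map_eq {K V W : Type*} [Field K] [AddCommGroup V]
    [Module K V] [AddCommGroup W] [Module K W] (π : V →ₗ[K] W) {Hf Df : Submodule K V}
    {Hg Dg : Submodule K W} (hH : Hf.map π = Hg) (hD : Df.map π ≤ Dg) [FiniteDimensional K Hf] :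
    Module.finrank K (Hg ⧸ Dg.comap Hg.subtype) ≤ Module.finrank K (Hf ⧸ Df.comap Hf.subtype) := by
  -- the restriction of `π` to `Hf → Hg`
  have hres : ∀ x ∈ Hf, π x ∈ Hg := fun x hx => by
    rw [← hH]; exact Submodule.mem_map_of_mem hx
  have hle : Df.comap Hf.subtype ≤ (Dg.comap Hg.subtype).comap (π.restrict hres) := by
    intro x hx
    simp only [Submodule.mem_comap, Submodule.subtype_apply, LinearMap.coe_restrict_apply] at hx ⊢
    exact hD (Submodule.mem_map_of_mem hx)
  -- the induced map of quotients is surjective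
  have hsurj : Function.Surjective
      ((Df.comap Hf.subtype).mapQ (Dg.comap Hg.subtype) (π.restrict hres) hle) := by
    intro z
    obtain ⟨y, rfl⟩ := Submodule.Quotient.mk_surjective _ z
    have hy : (y : W) ∈ Hf.map π := by rw [hH]; exact y.2
    obtain ⟨x, hx, hxy⟩ := hy
    refine ⟨Submodule.Quotient.mk ⟨x, hx⟩, ?_⟩
    rw [Submodule.mapQ_apply]
    congr 1
    exact Subtype.ext hxy
  exact LinearMap.finrank_le_finrank_of_surjective hsurj

variable {σ : Type*} [Fintype σ] [LinearOrder σ] {k : Type*} [Field k]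

/-- **Highest-weight vectors restrict surjectively.** For `g ∈ Δ(f)` (characteristic zero) the
restriction `k[Δ_m f] ↠ k[Δ_m g]` maps the highest-weight space of weight `χ` of `k[Δ_m f]` ONTO
that of `k[Δ_m g]`: the restriction is a `GL`-equivariant surjection and `k[Δ_m f]` is completely
reducible, so highest-weight vectors lift (Bläser–Ikenmeyer 2025, Cor. 12.6 with Prop. 12.7; tree
`map_highestWeightSpace_eq_of_surjective`). [folklore] -/
theorem map_orbitCoordRestrict_highestWeightSpace [CharZero k] {f g : MvPolynomial σ k} (m : ℕ)
    (h : g ∈ orbitClosure f) (χ : Weight σ) :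
    (highestWeightSpace (orbitCoordRep f m) χ).map (orbitCoordRestrict m h).toLinearMap =
      highestWeightSpace (orbitCoordRep g m) χ := by
  -- restriction as an intertwining map, and its surjectivity
  let π : (orbitCoordRep f m).IntertwiningMap (orbitCoordRep g m) :=
    { toLinearMap := (orbitCoordRestrict m h).toLinearMap
      isIntertwining' := fun A => by
        refine LinearMap.ext fun x => ?_
        obtain ⟨F, rfl⟩ := Ideal.Quotient.mk_surjective x
        simp only [LinearMap.coe_comp, Function.comp_apply, AlgHom.toLinearMap_apply,
          orbitCoordRep_apply, orbitCoordSubst_mk, orbitCoordRestrict_mk] }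
  have hπ : Function.Surjective π := by
    intro y
    obtain ⟨F, rfl⟩ := Ideal.Quotient.mk_surjective y
    exact ⟨Ideal.Quotient.mk _ F, orbitCoordRestrict_mk m h F⟩
  exact map_highestWeightSpace_eq_of_surjective π hπ (isSemisimpleRepresentation_orbitCoordRep f m) χ

/-- **The decomposable part restricts surjectively.** Since restriction is an ALGEBRA map, it
carries products of highest-weight spaces to products (`Submodule.map_mul`) and suprema to
suprema, so the span of products `HWV_χ₁(f) · HWV_χ₂(f)` over `χ₁ + χ₂ = χ`, `χᵢ ≠ 0`, maps onto
the corresponding span for `g` (semigroup property of highest-weight vectors, BLMW 2011 §6.1;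
Derksen–Makam 2020 Lemma 1.3). [folklore] -/
theorem map_orbitCoordRestrict_decomposable [CharZero k] {f g : MvPolynomial σ k} (m : ℕ)
    (h : g ∈ orbitClosure f) (χ : Weight σ) :
    (⨆ p : Weight σ × Weight σ, ⨆ (_ : p.1 + p.2 = χ ∧ p.1 ≠ 0 ∧ p.2 ≠ 0),
        highestWeightSpace (orbitCoordRep f m) p.1 *
          highestWeightSpace (orbitCoordRep f m) p.2).map (orbitCoordRestrict m h).toLinearMap =
      ⨆ p : Weight σ × Weight σ, ⨆ (_ : p.1 + p.2 = χ ∧ p.1 ≠ 0 ∧ p.2 ≠ 0),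
        highestWeightSpace (orbitCoordRep g m) p.1 * highestWeightSpace (orbitCoordRep g m) p.2 := by
  simp only [Submodule.map_iSup, Submodule.map_mul, map_orbitCoordRestrict_highestWeightSpace]

/-- **The generator-obstruction principle** (route `GeneratorObstructions`, item
`stmt-ValiantsHypothesis-11658`, card P1a–b): over `ℂ`, for `m ≠ 0` and `g ∈ Δ(f)`, the number
`γ_χ` of minimal generators of type `χ` of the algebra of highest-weight vectors of `ℂ[Δ_m ·]`
(dimension of `HWV_χ` modulo its intersection with the span of products of highest-weight spaces
of complementary nonzero weights) satisfies `γ_χ(g) ≤ γ_χ(f)` for every weight `χ`.  Restriction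
`ℂ[Δ_m f] ↠ ℂ[Δ_m g]` is an equivariant algebra surjection out of a completely reducible module,
so `HWV_χ` and the decomposable part both surject, and `finrank` is monotone along the induced
surjection of quotients (`HWV_χ(f)` is finite-dimensional for `m ≠ 0`). [folklore] -/
theorem genPrinciple_proof :
    Summit.ValiantsHypothesis.ValiantsHypothesis.Theses.GeneratorObstructions.GenPrinciple := by
  intro σ _ _ f g m hm h χ
  haveI : FiniteDimensional ℂ (highestWeightSpace (orbitCoordRep f m) χ) :=
    finiteDimensional_highestWeightSpace_orbitCoordRep_holds f hm χ
  exact finrank_quotient_comap_le_of_map_eq (orbitCoordRestrict m h).toLinearMap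
    (map_orbitCoordRestrict_highestWeightSpace m h χ) (map_orbitCoordRestrict_decomposable m h χ).le

end Summit.ValiantsHypothesis.ValiantsHypothesis.Theorems.GeneratorObstructionsGenPrinciple
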